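import Mathlib
import Literature.RingTheory.CohomologyAnnihilator.StableAnnihilation
import Summits.ResolutionOfSingularities.ResolutionOfSingularities.Theorems.HomologicalConductorPersistenceTwoStepTransferExponentTwo
import HarnessLib

/-!
# The syzygy-finite floor: stable annihilation of (third) syzygies lands in `ca⁴`

Rung S-2 `PersistenceSurface` (stmt-ResolutionOfSingularities-19970) of crux
`HomologicalConductor.Persistence` (stmt-ResolutionOfSingularities-16484), chain W4.4b, stub worker 3
(gen 6), memo `L/res-L1-w44b-stub-3/g6/Z13-PRONG-R.md` («LEMMA R»). `[OURS · L1 w44b]`; folklore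
homological algebra, NOT a statement of any manuscript; AI-written, weaker than expert review.

The algebraic half of LEMMA R. At a rational normal surface singularity `P` the first syzygies of
maximal Cohen–Macaulay modules form `add` of finitely many modules (Iyama–Wemyss 2010, Thm 3.6(a):
the duals of the special CM modules), so an element `c` stably annihilating those finitely many
modules stably annihilates `Ω X` for every MCM `X = Ω² M`; this file proves that such a `c` kills
`Extⁱ(M, −)` for `i ≥ 4`, i.e. `c ∈ ca⁴(P)`. Nothing about rationality, dimension or MCM modules
is formalised here: the input is phrased as three short exact sequences
`0 → K₃ → P₂ → K₂ → 0`, `0 → K₂ → P₁ → K₁ → 0`, `0 → K₁ → P₀ → M → 0` with projective middle terms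
and a stable factorisation `K₃ —ι→ Q —π→ K₃`, `ι ≫ π = c • 𝟙 K₃`, `Q` projective.

* `smul_ext_X₃_eq_zero_of_shortExact_of_projective` — dimension shifting for annihilators in the
  SURJECTIVE direction: `0 → X₁ → X₂ → X₃ → 0` short exact with `X₂` projective, `1 + n₀ = n₁`,
  `1 ≤ n₁`: if `c` kills `Ext^{n₀}(X₁, N)` then `c` kills `Ext^{n₁}(X₃, N)` (the connecting map
  `Ext^{n₀}(X₁,N) → Ext^{n₁}(X₃,N)` is `R`-linear and onto). The tree's
  `smul_ext_eq_zero_of_shortExact_of_projective` (`StableAnnihilation`) is the injective direction;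
  `mul_smul_ext_X₃_eq_zero_of_shortExact` (`…TwoStepTransferExponentTwo`) the general middle term.
* `smul_ext_eq_zero_of_syzygy_comp_eq_smul_id` — one syzygy: `0 → K → P → X → 0`, `P` projective,
  `c • 𝟙 K` factors through a projective ⟹ `c • Extⁱ(X, N) = 0` for all `N`, all `i ≥ 2`.
* `smul_ext_X₃_eq_zero_of_forall_le` — the same for a whole range `i ≥ m` ⟹ `i ≥ m + 1`;
  `smul_ext_eq_zero_of_syzygy₃_comp_eq_smul_id` — three syzygies: `i ≥ 4`.
* `comp_eq_smul_id_of_retract`, `comp_eq_smul_id_biprod` — stable factorisations pass to retracts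
  and binary biproducts (so to `add` of a finite family).
* `mem_cohomologyAnnihilatorOfDegree_four_of_forall_syzygy₃` — in `ModuleCat P`: if every finitely
  generated module has a third syzygy (along projective modules) on which `c • 𝟙` factors through a
  projective, then `c ∈ ca⁴(P)` (`Literature.RingTheory.CohomologyAnnihilator.cohomologyAnnihilatorOfDegree`).
-/

-- single-problem summit: the doubled namespace component is forced
set_option linter.dupNamespace false

namespace Summit.ResolutionOfSingularities.ResolutionOfSingularities.Theorems.HomologicalConductor.PersistenceSyzygyFiniteFloor

open CategoryTheory CategoryTheory.Abelian CategoryTheory.Limits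
open Literature.RingTheory.CohomologyAnnihilator
open Summit.ResolutionOfSingularities.ResolutionOfSingularities.Theorems.HomologicalConductor.PersistenceTwoStepTransferExponentTwo

/-! ## In an `R`-linear abelian category -/

section Ext

universe w t v u

variable {R : Type t} [Ring R] {𝒞 : Type u} [Category.{v} 𝒞] [Abelian 𝒞] [Linear R 𝒞]
  [HasExt.{w} 𝒞]

/-- **Dimension shifting for annihilators, surjective direction.** Let `0 → X₁ → X₂ → X₃ → 0` be
short exact with `X₂` projective, `1 + n₀ = n₁` and `1 ≤ n₁`. If `c` kills `Ext^{n₀}(X₁, N)` then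
`c` kills `Ext^{n₁}(X₃, N)`: every class of `Ext^{n₁}(X₃, N)` restricts to `0 = Ext^{n₁}(X₂, N)`,
hence is a connecting image `∂ x₁`, and `c • ∂ x₁ = ∂ (c • x₁) = 0`. [folklore] -/
theorem smul_ext_X₃_eq_zero_of_shortExact_of_projective {S : ShortComplex 𝒞} (hS : S.ShortExact)
    [Projective S.X₂] {N : 𝒞} {n₀ n₁ : ℕ} (hn : 1 + n₀ = n₁) (hn₁ : 1 ≤ n₁) {c : R}
    (hc : ∀ e : Ext S.X₁ N n₀, c • e = 0) (e : Ext S.X₃ N n₁) : c • e = 0 := by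
  have h := mul_smul_ext_X₃_eq_zero_of_shortExact hS hn (d := (1 : R))
    (fun e' => by rw [e'.eq_zero_of_hasProjectiveDimensionLT 1 hn₁, smul_zero]) hc e
  rwa [mul_one] at h

/-- **One syzygy.** Let `0 → K → P → X → 0` be short exact with `P` projective, and suppose the
homothety `c • 𝟙 K` factors through a projective object (`ι ≫ π = c • 𝟙 K`). Then `c` kills
`Extⁱ(X, N)` for every object `N` and every `i ≥ 2` (stable annihilation kills `Ext^{≥1}(K, −)`,
then shift). [folklore] -/
theorem smul_ext_eq_zero_of_syzygy_comp_eq_smul_id {S : ShortComplex 𝒞} (hS : S.ShortExact)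
    [Projective S.X₂] {Q : 𝒞} [Projective Q] (ι : S.X₁ ⟶ Q) (π : Q ⟶ S.X₁) {c : R}
    (h : ι ≫ π = c • 𝟙 S.X₁) {N : 𝒞} {i : ℕ} (hi : 2 ≤ i) (e : Ext S.X₃ N i) : c • e = 0 := by
  obtain ⟨j, rfl⟩ : ∃ j : ℕ, i = 1 + (j + 1) := ⟨i - 2, by omega⟩
  exact smul_ext_X₃_eq_zero_of_shortExact_of_projective hS rfl (by omega)
    (fun e' => smul_ext_eq_zero_of_comp_eq_smul_id ι π h (by omega) e') e

/-- **Shifting a whole range.** Let `0 → X₁ → X₂ → X₃ → 0` be short exact with `X₂`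
projective and `1 ≤ m`. If `c` kills `Extⁱ(X₁, N)` for all `i ≥ m`, then `c` kills `Extⁱ(X₃, N)` for
all `i ≥ m + 1`. [folklore] -/
theorem smul_ext_X₃_eq_zero_of_forall_le {S : ShortComplex 𝒞} (hS : S.ShortExact)
    [Projective S.X₂] {N : 𝒞} {m : ℕ} (hm : 1 ≤ m) {c : R}
    (hc : ∀ i : ℕ, m ≤ i → ∀ e : Ext S.X₁ N i, c • e = 0) {i : ℕ} (hi : m + 1 ≤ i)
    (e : Ext S.X₃ N i) : c • e = 0 := by
  obtain ⟨j, rfl⟩ : ∃ j : ℕ, i = 1 + j := ⟨i - 1, by omega⟩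
  exact smul_ext_X₃_eq_zero_of_shortExact_of_projective hS rfl (by omega)
    (fun e' => hc j (by omega) e') e

/-- **Three syzygies (explicit objects).** Let `0 → K₃ → P₂ → K₂ → 0`, `0 → K₂ → P₁ → K₁ → 0`,
`0 → K₁ → P₀ → M → 0` be short exact with `P₀`, `P₁`, `P₂` projective, and suppose `c • 𝟙 K₃`
factors through a projective object `Q`. Then `c` kills `Extⁱ(M, N)` for every `N` and every
`i ≥ 4`. (At a rational surface singularity: `K₂ = Ω² M` is MCM and `K₃ = Ω K₂` lies in `add` of
the finitely many duals of special CM modules — memo Z13-PRONG-R §2.) [folklore] -/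
theorem smul_ext_eq_zero_of_syzygy₃_comp_eq_smul_id {K₃ P₂ K₂ P₁ K₁ P₀ M : 𝒞}
    [Projective P₂] [Projective P₁] [Projective P₀]
    (f₂ : K₃ ⟶ P₂) (g₂ : P₂ ⟶ K₂) (w₂ : f₂ ≫ g₂ = 0) (hS₂ : (ShortComplex.mk f₂ g₂ w₂).ShortExact)
    (f₁ : K₂ ⟶ P₁) (g₁ : P₁ ⟶ K₁) (w₁ : f₁ ≫ g₁ = 0) (hS₁ : (ShortComplex.mk f₁ g₁ w₁).ShortExact)
    (f₀ : K₁ ⟶ P₀) (g₀ : P₀ ⟶ M) (w₀ : f₀ ≫ g₀ = 0) (hS₀ : (ShortComplex.mk f₀ g₀ w₀).ShortExact)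
    {Q : 𝒞} [Projective Q] (ι : K₃ ⟶ Q) (π : Q ⟶ K₃) {c : R} (h : ι ≫ π = c • 𝟙 K₃) {N : 𝒞}
    {i : ℕ} (hi : 4 ≤ i) (e : Ext M N i) : c • e = 0 := by
  haveI : Projective (ShortComplex.mk f₂ g₂ w₂).X₂ := ‹Projective P₂›
  haveI : Projective (ShortComplex.mk f₁ g₁ w₁).X₂ := ‹Projective P₁›
  haveI : Projective (ShortComplex.mk f₀ g₀ w₀).X₂ := ‹Projective P₀›
  have h₂ : ∀ j : ℕ, 2 ≤ j → ∀ e' : Ext K₂ N j, c • e' = 0 := fun j hj e' =>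
    smul_ext_eq_zero_of_syzygy_comp_eq_smul_id hS₂ ι π h hj e'
  have h₁ : ∀ j : ℕ, 3 ≤ j → ∀ e' : Ext K₁ N j, c • e' = 0 := fun j hj e' =>
    smul_ext_X₃_eq_zero_of_forall_le hS₁ (m := 2) (by omega) h₂ hj e'
  exact smul_ext_X₃_eq_zero_of_forall_le hS₀ (m := 3) (by omega) h₁ hi e

/-! ### Stable factorisations pass to `add` of a family: retracts and binary biproducts -/

omit [HasExt.{w} 𝒞] in
/-- If `c • 𝟙 Y` factors through an object `Q` and `K` is a retract of `Y` (`r ≫ s = 𝟙 K`), then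
`c • 𝟙 K` factors through the same `Q`. [folklore] -/
theorem comp_eq_smul_id_of_retract {K Y Q : 𝒞} (r : K ⟶ Y) (s : Y ⟶ K) (hrs : r ≫ s = 𝟙 K)
    (ι : Y ⟶ Q) (π : Q ⟶ Y) {c : R} (h : ι ≫ π = c • 𝟙 Y) :
    (r ≫ ι) ≫ (π ≫ s) = c • 𝟙 K := by
  rw [Category.assoc, ← Category.assoc ι, h, Linear.smul_comp, Category.id_comp,
    Linear.comp_smul, hrs]

omit [HasExt.{w} 𝒞] in
/-- If `c • 𝟙 Y₁` and `c • 𝟙 Y₂` factor through objects `Q₁`, `Q₂`, then `c • 𝟙 (Y₁ ⊞ Y₂)` factors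
through `Q₁ ⊞ Q₂` (which is projective when `Q₁`, `Q₂` are). [folklore] -/
theorem comp_eq_smul_id_biprod {Y₁ Y₂ Q₁ Q₂ : 𝒞} (ι₁ : Y₁ ⟶ Q₁) (π₁ : Q₁ ⟶ Y₁)
    (ι₂ : Y₂ ⟶ Q₂) (π₂ : Q₂ ⟶ Y₂) {c : R} (h₁ : ι₁ ≫ π₁ = c • 𝟙 Y₁) (h₂ : ι₂ ≫ π₂ = c • 𝟙 Y₂) :
    biprod.map ι₁ ι₂ ≫ biprod.map π₁ π₂ = c • 𝟙 (Y₁ ⊞ Y₂) := by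
  ext <;> simp [h₁, h₂]

end Ext

/-! ## In `ModuleCat P`: membership in `ca⁴(P)` -/

section ModuleCat

universe u

variable {P : Type u} [CommRing P]

/-- **The syzygy-finite floor in the currency `ca⁴`.** If every finitely generated `P`-module `M`
admits short exact sequences `0 → K₁ → P₀ → M → 0`, `0 → K₂ → P₁ → K₁ → 0`, `0 → K₃ → P₂ → K₂ → 0`
in `ModuleCat P` with `P₀`, `P₁`, `P₂` projective and a factorisation `ι ≫ π = c • 𝟙 K₃` through a
projective module `Q`, then `c ∈ ca⁴(P)`. This is the formal half of LEMMA R of memo Z13-PRONG-R: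
at a rational normal surface singularity every such `K₃ = Ω(Ω² M)` is a direct summand of a finite
sum of duals of special CM modules, so `⋂ᵢ s-ann(Nᵢ) ⊆ ca⁴(P)`. [folklore] -/
theorem mem_cohomologyAnnihilatorOfDegree_four_of_forall_syzygy₃ {c : P}
    (h : ∀ M : ModuleCat.{u} P, Module.Finite P M →
      ∃ (K₃ P₂ K₂ P₁ K₁ P₀ Q : ModuleCat.{u} P) (_ : Projective P₂) (_ : Projective P₁)
        (_ : Projective P₀) (_ : Projective Q)
        (f₂ : K₃ ⟶ P₂) (g₂ : P₂ ⟶ K₂) (w₂ : f₂ ≫ g₂ = 0) (_ : (ShortComplex.mk f₂ g₂ w₂).ShortExact)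
        (f₁ : K₂ ⟶ P₁) (g₁ : P₁ ⟶ K₁) (w₁ : f₁ ≫ g₁ = 0) (_ : (ShortComplex.mk f₁ g₁ w₁).ShortExact)
        (f₀ : K₁ ⟶ P₀) (g₀ : P₀ ⟶ M) (w₀ : f₀ ≫ g₀ = 0) (_ : (ShortComplex.mk f₀ g₀ w₀).ShortExact)
        (ι : K₃ ⟶ Q) (π : Q ⟶ K₃), ι ≫ π = c • 𝟙 K₃) :
    c ∈ cohomologyAnnihilatorOfDegree P 4 := by
  rw [mem_cohomologyAnnihilatorOfDegree_iff]
  intro i hi M N hM _ e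
  obtain ⟨K₃, P₂, K₂, P₁, K₁, P₀, Q, _, _, _, _, f₂, g₂, w₂, hS₂, f₁, g₁, w₁, hS₁, f₀, g₀, w₀, hS₀,
    ι, π, hιπ⟩ := h M hM
  exact smul_ext_eq_zero_of_syzygy₃_comp_eq_smul_id f₂ g₂ w₂ hS₂ f₁ g₁ w₁ hS₁ f₀ g₀ w₀ hS₀ ι π
    hιπ hi e

/-- `ca⁴(P) ≤ ca(P)`: under the hypothesis of
`mem_cohomologyAnnihilatorOfDegree_four_of_forall_syzygy₃`, `c` lies in the cohomology
annihilator `ca(P)`. [folklore] -/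
theorem mem_cohomologyAnnihilator_of_forall_syzygy₃ {c : P}
    (h : ∀ M : ModuleCat.{u} P, Module.Finite P M →
      ∃ (K₃ P₂ K₂ P₁ K₁ P₀ Q : ModuleCat.{u} P) (_ : Projective P₂) (_ : Projective P₁)
        (_ : Projective P₀) (_ : Projective Q)
        (f₂ : K₃ ⟶ P₂) (g₂ : P₂ ⟶ K₂) (w₂ : f₂ ≫ g₂ = 0) (_ : (ShortComplex.mk f₂ g₂ w₂).ShortExact)
        (f₁ : K₂ ⟶ P₁) (g₁ : P₁ ⟶ K₁) (w₁ : f₁ ≫ g₁ = 0) (_ : (ShortComplex.mk f₁ g₁ w₁).ShortExact)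
        (f₀ : K₁ ⟶ P₀) (g₀ : P₀ ⟶ M) (w₀ : f₀ ≫ g₀ = 0) (_ : (ShortComplex.mk f₀ g₀ w₀).ShortExact)
        (ι : K₃ ⟶ Q) (π : Q ⟶ K₃), ι ≫ π = c • 𝟙 K₃) :
    c ∈ cohomologyAnnihilator P :=
  cohomologyAnnihilatorOfDegree_le 4 (mem_cohomologyAnnihilatorOfDegree_four_of_forall_syzygy₃ h)

end ModuleCat

/-! ## `add` of a finite family (appended, gen 6 part 2)

The hypothesis of LEMMA R in the form Iyama–Wemyss deliver it: the third syzygy is a RETRACT of a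
finite biproduct `⨁ (S ∘ a)` (`a : J → I`, `J` finite) of members of a family `S` each of which `c`
stably annihilates. -/

section AddFamily

universe t' v' u'

variable {R : Type t'} [Ring R] {𝒞 : Type u'} [Category.{v'} 𝒞] [Abelian 𝒞] [Linear R 𝒞]
  [HasFiniteBiproducts 𝒞]

/-- Stable factorisations pass to finite biproducts (in an abelian category with chosen finite
biproducts — `HasFiniteBiproducts` is only a local instance for abelian categories in Mathlib, a
global one for `ModuleCat`): if `ι j ≫ π j = c • 𝟙 (f j)` for every `j`, then
`biproduct.map ι ≫ biproduct.map π = c • 𝟙 (⨁ f)`. [folklore] -/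
theorem comp_eq_smul_id_biproduct {J : Type v'} [Finite J] {f Q : J → 𝒞} (ι : ∀ j, f j ⟶ Q j)
    (π : ∀ j, Q j ⟶ f j) {c : R} (h : ∀ j, ι j ≫ π j = c • 𝟙 (f j)) :
    biproduct.map ι ≫ biproduct.map π = c • 𝟙 (⨁ f) := by
  classical
  ext j j'
  simp only [Category.assoc, biproduct.ι_map_assoc, biproduct.map_π, Linear.comp_smul,
    Linear.smul_comp, Category.id_comp]
  by_cases hjj : j' = j
  · subst hjj
    rw [biproduct.ι_π_self_assoc, h, biproduct.ι_π_self]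
  · rw [biproduct.ι_π_ne_assoc _ hjj, biproduct.ι_π_ne _ hjj, zero_comp, comp_zero, smul_zero]

/-- A finite biproduct of projective objects is projective (Mathlib's instance, recorded as a
theorem usable under binders). [folklore] -/
theorem projective_biproduct {J : Type v'} [Finite J] (Q : J → 𝒞) (hQ : ∀ j, Projective (Q j)) :
    Projective (⨁ Q) := by
  haveI := hQ
  infer_instance

/-- **Stable annihilation of `add` of a family.** If `c • 𝟙 (S i)` factors through a projective
object for every member `S i` of a family, and `K` is a retract (`r ≫ s = 𝟙 K`) of a finite
biproduct `⨁ (S ∘ a)` of members of the family, then `c • 𝟙 K` factors through a projective object.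
[folklore] -/
theorem exists_comp_eq_smul_id_of_retract_biproduct {I : Type*} (S : I → 𝒞) {c : R}
    (hS : ∀ i, ∃ (Q : 𝒞) (_ : Projective Q) (ι : S i ⟶ Q) (π : Q ⟶ S i), ι ≫ π = c • 𝟙 (S i))
    {J : Type v'} [Finite J] (a : J → I) {K : 𝒞} (r : K ⟶ ⨁ (S ∘ a)) (s : ⨁ (S ∘ a) ⟶ K)
    (hrs : r ≫ s = 𝟙 K) :
    ∃ (Q : 𝒞) (_ : Projective Q) (ι : K ⟶ Q) (π : Q ⟶ K), ι ≫ π = c • 𝟙 K := by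
  classical
  choose Q hQ ι π hιπ using hS
  refine ⟨⨁ (Q ∘ a), projective_biproduct (Q ∘ a) fun j => hQ (a j),
    r ≫ biproduct.map fun j => ι (a j), (biproduct.map fun j => π (a j)) ≫ s, ?_⟩
  exact comp_eq_smul_id_of_retract r s hrs _ _
    (comp_eq_smul_id_biproduct (f := S ∘ a) (fun j => ι (a j)) (fun j => π (a j)) fun j => hιπ (a j))

end AddFamily

/-! ## In `ModuleCat P`: the `add S` form of the floor -/

section ModuleCatAdd

universe u'

variable {P : Type u'} [CommRing P]

/-- **LEMMA R, algebraic half, in the shape Iyama–Wemyss deliver it.** Let `S` be a family of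
`P`-modules each stably annihilated by `c` (e.g. the finitely many duals of the special CM modules
of a rational surface singularity together with `P` itself), and suppose every finitely generated
`M` has short exact sequences `0 → K₁ → P₀ → M → 0`, `0 → K₂ → P₁ → K₁ → 0`, `0 → K₃ → P₂ → K₂ → 0`
with projective middle terms and `K₃` a retract of a finite biproduct of members of `S`
(`K₃ ∈ add S`; at a rational surface singularity: Iyama–Wemyss 2010 Thm 3.6(a), `Ω(Ω² M) ∈ OCM(P)
= add{P, Nᵢ*}`). Then `c ∈ ca⁴(P)`. [folklore] -/
theorem mem_cohomologyAnnihilatorOfDegree_four_of_syzygy₃_mem_add {c : P} {I : Type*}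
    (S : I → ModuleCat.{u'} P)
    (hS : ∀ i, ∃ (Q : ModuleCat.{u'} P) (_ : Projective Q) (ι : S i ⟶ Q) (π : Q ⟶ S i),
      ι ≫ π = c • 𝟙 (S i))
    (h : ∀ M : ModuleCat.{u'} P, Module.Finite P M →
      ∃ (K₃ P₂ K₂ P₁ K₁ P₀ : ModuleCat.{u'} P) (_ : Projective P₂) (_ : Projective P₁)
        (_ : Projective P₀)
        (f₂ : K₃ ⟶ P₂) (g₂ : P₂ ⟶ K₂) (w₂ : f₂ ≫ g₂ = 0) (_ : (ShortComplex.mk f₂ g₂ w₂).ShortExact)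
        (f₁ : K₂ ⟶ P₁) (g₁ : P₁ ⟶ K₁) (w₁ : f₁ ≫ g₁ = 0) (_ : (ShortComplex.mk f₁ g₁ w₁).ShortExact)
        (f₀ : K₁ ⟶ P₀) (g₀ : P₀ ⟶ M) (w₀ : f₀ ≫ g₀ = 0) (_ : (ShortComplex.mk f₀ g₀ w₀).ShortExact)
        (J : Type u') (_ : Finite J) (a : J → I) (r : K₃ ⟶ ⨁ (S ∘ a)) (s : ⨁ (S ∘ a) ⟶ K₃),
        r ≫ s = 𝟙 K₃) :
    c ∈ cohomologyAnnihilatorOfDegree P 4 := by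
  refine mem_cohomologyAnnihilatorOfDegree_four_of_forall_syzygy₃ fun M hM => ?_
  obtain ⟨K₃, P₂, K₂, P₁, K₁, P₀, hP₂, hP₁, hP₀, f₂, g₂, w₂, hS₂, f₁, g₁, w₁, hS₁, f₀, g₀, w₀, hS₀,
    J, hJ, a, r, s, hrs⟩ := h M hM
  obtain ⟨Q, hQ, ι, π, hιπ⟩ := exists_comp_eq_smul_id_of_retract_biproduct S hS a r s hrs
  exact ⟨K₃, P₂, K₂, P₁, K₁, P₀, Q, hP₂, hP₁, hP₀, hQ, f₂, g₂, w₂, hS₂, f₁, g₁, w₁, hS₁, f₀, g₀, w₀,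
    hS₀, ι, π, hιπ⟩

end ModuleCatAdd

end Summit.ResolutionOfSingularities.ResolutionOfSingularities.Theorems.HomologicalConductor.PersistenceSyzygyFiniteFloor
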